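import Summits.HodgeConjecture.HodgeConjecture.Theorems.F0P2oFrameOfFormCongruence        -- ★ p831733: columns of a form congruence, `conj_*_mulVec_*`, line tensoring
import HarnessLib

/-!
# Crux `H413`, programme P2, N3 road (S2)-b part 3b (generic half) — THE PAIR FRAME PACKAGE: the hyperbolic frame of `V ⊗ W` (`W` a hermitian line)
# from a form congruence of `V`, VERBATIM in the shape consumed by the abstract assembler ★ p831955, and the frame action of
# `reindex e (T_c m T_c⁻¹ ⊗ 1)` for `m` upper unitriangular ∕ diagonal

Cell hodgecm-mathlib (D-0151), FLOOR 0, crux item H413 = stmt-HodgeConjecture-24833, programme P2; N3 road (`F0/P2/B-p18/g28/N3-ROAD.v1.B-p18g28.md`)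
§2 (S2), desk F0P2-plan (g8) 18:45:24Z «(S2)-b TRANSPORT».  Seat A-p12 (g17); sequel of ★ p831733 (part 2b) feeding ★ p831955 (part 3a,
`exists_coinvariants_equiv_of_frame`).  THEOREMS ONLY (no `def`, no instance, no notation, no named fact, no `sorry`); never imports a `Cruxes/…/Lines` module;
kernel lane `--supports stmt-HodgeConjecture-24833 --as helper`.  HC_CM is proved only modulo the printed citations until rung 0 closes; nothing printed is asserted.

SETTING (any commutative ring `S` with `σ`).  `H_V ∈ M₃(S)`, `H_W ∈ M₁(S)` (the line, `ε′ = (H_W)₀₀`), the pair form `H = reindex e e (H_V ⊗ H_W)` on `S^{n′}`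
(`e : Fin 3 × Fin 1 ≃ Fin n′`, ★ `localLineInl`'s reindexing), the lift `L x = x ⊗ w₀` (`L x k = x (e⁻¹ k).1`), a congruence matrix `T_c ∈ GL₃(S)` and a unit `u`
with `B_V(T_c eᵢ, T_c eⱼ) · ε′ = u · [i + j = 2]` (`hcc`; in the CM application `u = a ε′` from ★ `xThetaGqsCM`'s `formCongr σ T_c H_V = a • Φ₃`, ★ p831733
`hermForm_col_col_eq`).  THE FRAME: `x₀ = L(T_c e₀)`, `y₀ = L(u⁻¹ T_c e₂)`, `b = ![L(T_c e₁)]` (`m = 1`).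

* §1 `hermForm_pair_col_col` and the binders of ★ p831955 VERBATIM: `pairFrame_hx ∕ _hy ∕ _hxy ∕ _hxb ∕ _hyb ∕ _hbb ∕ _hba` and **`pairFrame_hexp`**
  (`v = B(y₀,v) x₀ + B(x₀,v) y₀ + Σⱼ (u⁻¹ B(bⱼ,v)) bⱼ`; `L` is onto since `W` is a line: `pairLift_surjective`).
* §2 the frame action of `G = reindex e e ((T_c m T_c⁻¹) ⊗ 1)`: **`pairFrame_action_upper`** (`m = u(x′,y′,z′)`: `G x₀ = x₀`, `G b₀ = b₀ + x′ x₀`,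
  `G y₀ = y₀ + (y′u⁻¹) b₀ + (z′u⁻¹) x₀` — the `hN` of ★ p831955 and, at `x′ = y′ = 0`, its `hZ`: `pairFrame_action_centre`), **`pairFrame_action_diagonal`**
  (`G x₀ = d₀ x₀`, `G bⱼ = d₁ bⱼ` — the frame part of `hgen`).
So the CM closer of N3 (a) only instantiates types: `S = LocalRing L v`, `H_V = diag dV ⊗ 1`, `H_W = (ε)`, `T_c, a` from ★ `xThetaGqsCM`, `M g = reindex e₁ (T_c g T_c⁻¹ ⊗ 1)`
(F0P3a-p03's docking matrix), the matrices of `n⁻¹ ∈ N` ∕ `t⁻¹ ∈ T` from ★ p831034 ∕ ★ p831536.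
[MoeglinVignerasWaldspurger1987, Chap. 1 I.17, Chap. 3 §IV.2; Dieudonne1971GroupesClassiques, Chap. II §5; Rogawski1990, §1.9–1.10.]

## References
* [MoeglinVignerasWaldspurger1987] C. Mœglin, M.-F. Vignéras, J.-L. Waldspurger, *Correspondances de Howe sur un corps p-adique*, LNM 1291 (1987): Chap. 1 I.17, Chap. 3 §IV.2.
* [Dieudonne1971GroupesClassiques] J. Dieudonné, *La géométrie des groupes classiques* (1971): Chap. II §5.
* [Rogawski1990] J. D. Rogawski, Ann. of Math. Stud. 123 (1990): §1.9 p. 8, §1.10 p. 9.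
-/

set_option autoImplicit false
set_option linter.dupNamespace false -- the mandated namespace repeats the single-problem summit's segment

open scoped MatrixGroups Kronecker
open _root_.Matrix
open Literature.NumberTheory.Automorphic Literature.NumberTheory.Automorphic.UnitaryGroup
open Summit.HodgeConjecture.HodgeConjecture.Cruxes.H413.F0P2oFrameOfFormCongruence

namespace Summit.HodgeConjecture.HodgeConjecture.Cruxes.H413.F0P2oPairFrameOfFormCongruence

variable {S : Type*} [CommRing S] (σ : S →+* S) (HV : Matrix (Fin 3) (Fin 3) S) (HW : Matrix (Fin 1) (Fin 1) S)
  {n' : ℕ} (e : Fin 3 × Fin 1 ≃ Fin n') (L : (Fin 3 → S) →ₗ[S] (Fin n' → S)) (hL : ∀ (x : Fin 3 → S) (k : Fin n'), L x k = x (e.symm k).1)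
  (Tc : GL (Fin 3) S) (u : Sˣ)
  (hcc : ∀ i j : Fin 3, hermForm σ HV ((Tc : Matrix (Fin 3) (Fin 3) S).col i) ((Tc : Matrix (Fin 3) (Fin 3) S).col j) * HW 0 0 =
    if i.val + j.val + 1 = 3 then (u : S) else 0)

/-! ## §1 The frame `x₀ = L(T_c e₀)`, `y₀ = L(u⁻¹ T_c e₂)`, `b = ![L(T_c e₁)]` and the binders of ★ p831955 -/

include hL in
/-- **`L` is onto** (`W` is a line: `v = L (i ↦ v (e (i, 0)))`). [cite: MoeglinVignerasWaldspurger1987, Chap. 1 I.17] -/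
theorem pairLift_surjective (v : Fin n' → S) : L (fun i => v (e (i, 0))) = v := by
  funext k
  rw [hL]
  have hk : ((e.symm k).1, (0 : Fin 1)) = e.symm k := Prod.ext rfl (Subsingleton.elim _ _)
  rw [hk, Equiv.apply_symm_apply]

include hL hcc in
/-- the pair pairings of the lifted columns: `B(L T_c eᵢ, L T_c eⱼ) = u · [i + j = 2]` (★ p831733 `hermForm_reindex_kronecker`).
[cite: MoeglinVignerasWaldspurger1987, Chap. 1 I.17] -/
theorem hermForm_pair_col_col (i j : Fin 3) :
    hermForm σ (Matrix.reindex e e (HV ⊗ₖ HW)) (L ((Tc : Matrix (Fin 3) (Fin 3) S).col i)) (L ((Tc : Matrix (Fin 3) (Fin 3) S).col j)) =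
      if i.val + j.val + 1 = 3 then (u : S) else 0 := by
  rw [hermForm_reindex_kronecker σ e L hL, hcc]

include hL hcc in
/-- `hx` of ★ p831955: `B(x₀, x₀) = 0`. [cite: Dieudonne1971GroupesClassiques, Chap. II §5] -/
theorem pairFrame_hx :
    hermForm σ (Matrix.reindex e e (HV ⊗ₖ HW)) (L ((Tc : Matrix (Fin 3) (Fin 3) S).col 0)) (L ((Tc : Matrix (Fin 3) (Fin 3) S).col 0)) = 0 := by
  rw [hermForm_pair_col_col σ HV HW e L hL Tc u hcc]; rfl

include hL hcc in
/-- `hy` of ★ p831955: `B(y₀, y₀) = 0`. [cite: Dieudonne1971GroupesClassiques, Chap. II §5] -/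
theorem pairFrame_hy :
    hermForm σ (Matrix.reindex e e (HV ⊗ₖ HW)) (L (((u⁻¹ : Sˣ) : S) • (Tc : Matrix (Fin 3) (Fin 3) S).col 2))
      (L (((u⁻¹ : Sˣ) : S) • (Tc : Matrix (Fin 3) (Fin 3) S).col 2)) = 0 := by
  rw [map_smul, hermForm_smul_left_eq, hermForm_smul_right, hermForm_pair_col_col σ HV HW e L hL Tc u hcc]
  simp

include hL hcc in
/-- `hxy` of ★ p831955: `B(x₀, y₀) = 1`. [cite: Dieudonne1971GroupesClassiques, Chap. II §5] -/
theorem pairFrame_hxy :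
    hermForm σ (Matrix.reindex e e (HV ⊗ₖ HW)) (L ((Tc : Matrix (Fin 3) (Fin 3) S).col 0))
      (L (((u⁻¹ : Sˣ) : S) • (Tc : Matrix (Fin 3) (Fin 3) S).col 2)) = 1 := by
  rw [map_smul, hermForm_smul_right, hermForm_pair_col_col σ HV HW e L hL Tc u hcc]
  simp

include hL hcc in
/-- `hxb` of ★ p831955: `B(x₀, b₀) = 0`. [cite: Dieudonne1971GroupesClassiques, Chap. II §5] -/
theorem pairFrame_hxb (j : Fin 1) :
    hermForm σ (Matrix.reindex e e (HV ⊗ₖ HW)) (L ((Tc : Matrix (Fin 3) (Fin 3) S).col 0))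
      ((![L ((Tc : Matrix (Fin 3) (Fin 3) S).col 1)] : Fin 1 → Fin n' → S) j) = 0 := by
  obtain rfl : j = 0 := Subsingleton.elim _ _
  rw [Matrix.cons_val_fin_one, hermForm_pair_col_col σ HV HW e L hL Tc u hcc]; rfl

include hL hcc in
/-- `hyb` of ★ p831955: `B(y₀, b₀) = 0`. [cite: Dieudonne1971GroupesClassiques, Chap. II §5] -/
theorem pairFrame_hyb (j : Fin 1) :
    hermForm σ (Matrix.reindex e e (HV ⊗ₖ HW)) (L (((u⁻¹ : Sˣ) : S) • (Tc : Matrix (Fin 3) (Fin 3) S).col 2))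
      ((![L ((Tc : Matrix (Fin 3) (Fin 3) S).col 1)] : Fin 1 → Fin n' → S) j) = 0 := by
  obtain rfl : j = 0 := Subsingleton.elim _ _
  rw [Matrix.cons_val_fin_one, map_smul, hermForm_smul_left_eq, hermForm_pair_col_col σ HV HW e L hL Tc u hcc]
  simp

omit hL in
/-- `hbb` of ★ p831955 (vacuous for a single `b₀`). [folklore] -/
theorem pairFrame_hbb (j j' : Fin 1) (h : j ≠ j') :
    hermForm σ (Matrix.reindex e e (HV ⊗ₖ HW)) ((![L ((Tc : Matrix (Fin 3) (Fin 3) S).col 1)] : Fin 1 → Fin n' → S) j)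
      ((![L ((Tc : Matrix (Fin 3) (Fin 3) S).col 1)] : Fin 1 → Fin n' → S) j') = 0 :=
  absurd (Subsingleton.elim j j') h

include hL hcc in
/-- `hba` of ★ p831955 with `φ(a₀) = u`: `B(b₀, b₀) = u` (the anisotropic middle line). [cite: Dieudonne1971GroupesClassiques, Chap. II §5] -/
theorem pairFrame_hba (j : Fin 1) :
    hermForm σ (Matrix.reindex e e (HV ⊗ₖ HW)) ((![L ((Tc : Matrix (Fin 3) (Fin 3) S).col 1)] : Fin 1 → Fin n' → S) j)
      ((![L ((Tc : Matrix (Fin 3) (Fin 3) S).col 1)] : Fin 1 → Fin n' → S) j) = u := by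
  obtain rfl : j = 0 := Subsingleton.elim _ _
  rw [Matrix.cons_val_fin_one, hermForm_pair_col_col σ HV HW e L hL Tc u hcc]; rfl

include hL hcc in
/-- the three frame functionals on `v = L (Σ cᵢ T_c eᵢ)`: `B(y₀, v) = c₀`, `B(x₀, v) = c₂ u`, `B(b₀, v) = c₁ u` (`σ u = u`, `c = T_c⁻¹ x`).
[cite: Dieudonne1971GroupesClassiques, Chap. II §5] -/
theorem hermForm_pairFrame_apply (hσu : σ (u : S) = u) (x : Fin 3 → S) :
    hermForm σ (Matrix.reindex e e (HV ⊗ₖ HW)) (L (((u⁻¹ : Sˣ) : S) • (Tc : Matrix (Fin 3) (Fin 3) S).col 2)) (L x) =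
        (((Tc⁻¹ : GL (Fin 3) S) : Matrix (Fin 3) (Fin 3) S) *ᵥ x) 0 ∧
      hermForm σ (Matrix.reindex e e (HV ⊗ₖ HW)) (L ((Tc : Matrix (Fin 3) (Fin 3) S).col 0)) (L x) =
        (((Tc⁻¹ : GL (Fin 3) S) : Matrix (Fin 3) (Fin 3) S) *ᵥ x) 2 * u ∧
      hermForm σ (Matrix.reindex e e (HV ⊗ₖ HW)) (L ((Tc : Matrix (Fin 3) (Fin 3) S).col 1)) (L x) =
        (((Tc⁻¹ : GL (Fin 3) S) : Matrix (Fin 3) (Fin 3) S) *ᵥ x) 1 * u := by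
  have hx : L x = ∑ i, (((Tc⁻¹ : GL (Fin 3) S) : Matrix (Fin 3) (Fin 3) S) *ᵥ x) i • L ((Tc : Matrix (Fin 3) (Fin 3) S).col i) := by
    conv_lhs => rw [eq_sum_inv_mulVec_smul_col Tc x]
    rw [map_sum]
    exact Finset.sum_congr rfl fun i _ => by rw [map_smul]
  have hcc' := hermForm_pair_col_col σ HV HW e L hL Tc u hcc
  refine ⟨?_, ?_, ?_⟩
  · rw [hx, hermForm_sum_right, Fin.sum_univ_three]
    simp only [hermForm_smul_right, map_smul, hermForm_smul_left_eq, map_units_inv_of_map_eq σ hσu, hcc']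
    simp
  · rw [hx, hermForm_sum_right, Fin.sum_univ_three]
    simp only [hermForm_smul_right, hcc']
    simp
  · rw [hx, hermForm_sum_right, Fin.sum_univ_three]
    simp only [hermForm_smul_right, hcc']
    simp

include hL hcc in
/-- **`hexp` of ★ p831955** (with `φ(a₀)⁻¹ = u⁻¹`): `v = B(y₀,v) x₀ + B(x₀,v) y₀ + Σⱼ (u⁻¹ B(bⱼ,v)) bⱼ`. [cite: Dieudonne1971GroupesClassiques, Chap. II §5] -/
theorem pairFrame_hexp (hσu : σ (u : S) = u) (v : Fin n' → S) :
    v = hermForm σ (Matrix.reindex e e (HV ⊗ₖ HW)) (L (((u⁻¹ : Sˣ) : S) • (Tc : Matrix (Fin 3) (Fin 3) S).col 2)) v •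
          L ((Tc : Matrix (Fin 3) (Fin 3) S).col 0) +
        hermForm σ (Matrix.reindex e e (HV ⊗ₖ HW)) (L ((Tc : Matrix (Fin 3) (Fin 3) S).col 0)) v •
          L (((u⁻¹ : Sˣ) : S) • (Tc : Matrix (Fin 3) (Fin 3) S).col 2) +
        ∑ j : Fin 1, (((u⁻¹ : Sˣ) : S) *
          hermForm σ (Matrix.reindex e e (HV ⊗ₖ HW)) ((![L ((Tc : Matrix (Fin 3) (Fin 3) S).col 1)] : Fin 1 → Fin n' → S) j) v) •
            (![L ((Tc : Matrix (Fin 3) (Fin 3) S).col 1)] : Fin 1 → Fin n' → S) j := by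
  -- write `v = L x`
  have hv := pairLift_surjective e L hL v
  set x : Fin 3 → S := fun i => v (e (i, 0)) with hxdef
  rw [← hv]
  obtain ⟨h0, h2, h1⟩ := hermForm_pairFrame_apply σ HV HW e L hL Tc u hcc hσu x
  rw [Fin.sum_univ_one, Matrix.cons_val_fin_one, h0, h2, h1, map_smul, smul_smul, Units.mul_inv_cancel_right, mul_left_comm, Units.inv_mul,
    mul_one]
  conv_lhs => rw [eq_sum_inv_mulVec_smul_col Tc x, map_sum, Fin.sum_univ_three, map_smul, map_smul, map_smul]
  abel

/-! ## §2 The frame action of `reindex e e ((T_c m T_c⁻¹) ⊗ 1)` -/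

include hL in
/-- **`m` upper unitriangular** (`hN` of ★ p831955, and `hZ` at `x′ = y′ = 0`): `G x₀ = x₀`, `G b₀ = b₀ + x′ x₀`, `G y₀ = y₀ + (y′u⁻¹) b₀ + (z′u⁻¹) x₀`
for `G = reindex e e ((T_c u(x′,y′,z′) T_c⁻¹) ⊗ 1)`. [cite: MoeglinVignerasWaldspurger1987, Chap. 3 §IV.2] [cite: Rogawski1990, §1.10 p. 9] -/
theorem pairFrame_action_upper (x' y' z' : S) :
    (Matrix.reindex e e (((Tc : Matrix (Fin 3) (Fin 3) S) * !![1, x', z'; 0, 1, y'; 0, 0, 1] * ((Tc⁻¹ : GL (Fin 3) S) : Matrix (Fin 3) (Fin 3) S)) ⊗ₖ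
        (1 : Matrix (Fin 1) (Fin 1) S))) *ᵥ L ((Tc : Matrix (Fin 3) (Fin 3) S).col 0) = L ((Tc : Matrix (Fin 3) (Fin 3) S).col 0) ∧
    (∀ j : Fin 1, ∃ μ : S,
      (Matrix.reindex e e (((Tc : Matrix (Fin 3) (Fin 3) S) * !![1, x', z'; 0, 1, y'; 0, 0, 1] * ((Tc⁻¹ : GL (Fin 3) S) : Matrix (Fin 3) (Fin 3) S)) ⊗ₖ
          (1 : Matrix (Fin 1) (Fin 1) S))) *ᵥ (![L ((Tc : Matrix (Fin 3) (Fin 3) S).col 1)] : Fin 1 → Fin n' → S) j =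
        (![L ((Tc : Matrix (Fin 3) (Fin 3) S).col 1)] : Fin 1 → Fin n' → S) j + μ • L ((Tc : Matrix (Fin 3) (Fin 3) S).col 0)) ∧
    (Matrix.reindex e e (((Tc : Matrix (Fin 3) (Fin 3) S) * !![1, x', z'; 0, 1, y'; 0, 0, 1] * ((Tc⁻¹ : GL (Fin 3) S) : Matrix (Fin 3) (Fin 3) S)) ⊗ₖ
        (1 : Matrix (Fin 1) (Fin 1) S))) *ᵥ L (((u⁻¹ : Sˣ) : S) • (Tc : Matrix (Fin 3) (Fin 3) S).col 2) =
      L (((u⁻¹ : Sˣ) : S) • (Tc : Matrix (Fin 3) (Fin 3) S).col 2) + (y' * ((u⁻¹ : Sˣ) : S)) • L ((Tc : Matrix (Fin 3) (Fin 3) S).col 1) +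
        (z' * ((u⁻¹ : Sˣ) : S)) • L ((Tc : Matrix (Fin 3) (Fin 3) S).col 0) := by
  obtain ⟨h0, h1, h2⟩ := conj_upper_mulVec_frame Tc u x' y' z'
  refine ⟨?_, fun j => ⟨x', ?_⟩, ?_⟩
  · rw [reindex_kronecker_one_mulVec e L hL, h0]
  · obtain rfl : j = 0 := Subsingleton.elim _ _
    rw [Matrix.cons_val_fin_one, reindex_kronecker_one_mulVec e L hL, h1, map_add, map_smul]
  · rw [reindex_kronecker_one_mulVec e L hL, h2, map_add, map_add, map_smul, map_smul, map_smul]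

include hL in
/-- **the centre** (`hZ` of ★ p831955): for `m = u(0, 0, z′)`, `G x₀ = x₀`, `G bⱼ = bⱼ`, `G y₀ = y₀ + (z′u⁻¹) x₀`. [cite: MoeglinVignerasWaldspurger1987, Chap. 3 §IV.2] -/
theorem pairFrame_action_centre (z' : S) :
    (Matrix.reindex e e (((Tc : Matrix (Fin 3) (Fin 3) S) * !![1, 0, z'; 0, 1, 0; 0, 0, 1] * ((Tc⁻¹ : GL (Fin 3) S) : Matrix (Fin 3) (Fin 3) S)) ⊗ₖ
        (1 : Matrix (Fin 1) (Fin 1) S))) *ᵥ L ((Tc : Matrix (Fin 3) (Fin 3) S).col 0) = L ((Tc : Matrix (Fin 3) (Fin 3) S).col 0) ∧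
    (∀ j : Fin 1,
      (Matrix.reindex e e (((Tc : Matrix (Fin 3) (Fin 3) S) * !![1, 0, z'; 0, 1, 0; 0, 0, 1] * ((Tc⁻¹ : GL (Fin 3) S) : Matrix (Fin 3) (Fin 3) S)) ⊗ₖ
          (1 : Matrix (Fin 1) (Fin 1) S))) *ᵥ (![L ((Tc : Matrix (Fin 3) (Fin 3) S).col 1)] : Fin 1 → Fin n' → S) j =
        (![L ((Tc : Matrix (Fin 3) (Fin 3) S).col 1)] : Fin 1 → Fin n' → S) j) ∧
    (Matrix.reindex e e (((Tc : Matrix (Fin 3) (Fin 3) S) * !![1, 0, z'; 0, 1, 0; 0, 0, 1] * ((Tc⁻¹ : GL (Fin 3) S) : Matrix (Fin 3) (Fin 3) S)) ⊗ₖ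
        (1 : Matrix (Fin 1) (Fin 1) S))) *ᵥ L (((u⁻¹ : Sˣ) : S) • (Tc : Matrix (Fin 3) (Fin 3) S).col 2) =
      L (((u⁻¹ : Sˣ) : S) • (Tc : Matrix (Fin 3) (Fin 3) S).col 2) + (z' * ((u⁻¹ : Sˣ) : S)) • L ((Tc : Matrix (Fin 3) (Fin 3) S).col 0) := by
  obtain ⟨h0, h1, h2⟩ := conj_upper_mulVec_frame Tc u 0 0 z'
  refine ⟨?_, fun j => ?_, ?_⟩
  · rw [reindex_kronecker_one_mulVec e L hL, h0]
  · obtain rfl : j = 0 := Subsingleton.elim _ _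
    rw [Matrix.cons_val_fin_one, reindex_kronecker_one_mulVec e L hL, h1, zero_smul, add_zero]
  · rw [reindex_kronecker_one_mulVec e L hL, h2, zero_mul, zero_smul, add_zero, map_add, map_smul, map_smul]

include hL in
/-- **`m` diagonal** (the frame part of `hgen` of ★ p831955): `G x₀ = d₀ x₀`, `G bⱼ = d₁ bⱼ`. [cite: Rogawski1990, §1.10 p. 9] -/
theorem pairFrame_action_diagonal (d : Fin 3 → S) :
    (∃ α : S, (Matrix.reindex e e (((Tc : Matrix (Fin 3) (Fin 3) S) * Matrix.diagonal d * ((Tc⁻¹ : GL (Fin 3) S) : Matrix (Fin 3) (Fin 3) S)) ⊗ₖ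
        (1 : Matrix (Fin 1) (Fin 1) S))) *ᵥ L ((Tc : Matrix (Fin 3) (Fin 3) S).col 0) = α • L ((Tc : Matrix (Fin 3) (Fin 3) S).col 0)) ∧
    ∀ j : Fin 1, ∃ ν : S,
      (Matrix.reindex e e (((Tc : Matrix (Fin 3) (Fin 3) S) * Matrix.diagonal d * ((Tc⁻¹ : GL (Fin 3) S) : Matrix (Fin 3) (Fin 3) S)) ⊗ₖ
          (1 : Matrix (Fin 1) (Fin 1) S))) *ᵥ (![L ((Tc : Matrix (Fin 3) (Fin 3) S).col 1)] : Fin 1 → Fin n' → S) j =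
        ν • (![L ((Tc : Matrix (Fin 3) (Fin 3) S).col 1)] : Fin 1 → Fin n' → S) j := by
  refine ⟨⟨d 0, ?_⟩, fun j => ⟨d 1, ?_⟩⟩
  · rw [reindex_kronecker_one_mulVec e L hL, conj_diagonal_mulVec_col Tc d 0, map_smul]
  · obtain rfl : j = 0 := Subsingleton.elim _ _
    rw [Matrix.cons_val_fin_one, reindex_kronecker_one_mulVec e L hL, conj_diagonal_mulVec_col Tc d 1, map_smul]

end Summit.HodgeConjecture.HodgeConjecture.Cruxes.H413.F0P2oPairFrameOfFormCongruence
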